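import Summits.QuantumFields.BalabanUV.T4Continuum.Support.NE7EJBracket

/-!
# NE7EJBracketIntegral — row NE7 (node U5), candidate route HOM, variant H1L-EJ: (E1) THE ENVELOPE INTEGRAL `Br = ∫₀¹ 𝔇(U_τ) dτ`
# ON THE REAL SLICE, FOR EVERY MINIMISER SELECTION, WITHOUT AN ENVELOPE THEOREM

Lineage `b2b-balaban-t4-ne7-p2` (CRUX PROVER NE7 #2 = C-HOM°'s kernel hand), generation 80; file 107 (sequel of 106 `NE7EJBracket`).
CONSUMER SHAPE (by name): lens 1's rider ▶v3.153 EJ-1b′ (`t4/ideate/NE7/lens1-g58/DEFECT-NOTE.md` §2 (E1)): «Let U_τ := critical point of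
A_c + τ𝔇 on S_V (U_0 = U^A, U_1 = U^B) and g(τ) := (A_c + τ𝔇)(U_τ). Then g′(τ) = 𝔇(U_τ) (the term ⟨δ(A_c + τ𝔇)(U_τ), ∂_τU_τ⟩ vanishes:
∂_τU_τ ∈ T S_V, U_τ critical), so Br = g(1) − g(0) = ∫₀¹ 𝔇(U_τ) dτ».  On the REAL SLICE (minimisers) the conclusion needs NONE of the
differentiability: for ANY selection `u` with `u τ ∈ S` minimising `A_τ` on `S` for every `τ ∈ [0,1]` (no uniqueness, no smoothness of
`τ ↦ u τ`, no Hessian hypothesis (H-inv), no topology on `X`):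
* `lineVal_telescope`, `sum_le_bracket_le_sum` — at every mesh `1∕n` the increment `n·(g(1) − g(0))` lies between the right and left
  Riemann sums `Σ_{i<n} 𝔇(u((i+1)∕n))` and `Σ_{i<n} 𝔇(u(i∕n))` (file 106's two-sided increments `increment_ge ∕ increment_le`);
* `sum_le_integral_le_sum` — so does `n·∫₀¹ f` for any `f` antitone on `[0,1]` (Mathlib's `AntitoneOn.sum_le_integral ∕ integral_le_sum`
  rescaled by `intervalIntegral.integral_comp_div`); `sum_sub_sum_eq` — the two sums differ by `f 0 − f 1`;
* **`lineVal_one_sub_zero_eq_integral`**: `g(1) − g(0) = ∫₀¹ 𝔇(u τ) dτ` (the integrand `τ ↦ 𝔇(u τ)` is antitone by file 106's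
  `defect_antitoneOn`, hence interval-integrable; `|n·Br − n·∫| ≤ 𝔇(u 0) − 𝔇(u 1)` for every `n` forces equality);
  **`bracket_eq_integral`** (`Br(u 0, u 1) = ∫₀¹ 𝔇(u τ) dτ`) and **`bracket_eq_integral'`** (the same for the bracket of ANY pair of endpoint
  minimisers `U^A`, `U^B` — the two minimum values do not depend on the minimiser chosen).

HONEST FRAMING: [folklore] (Riemann sums of a monotone function); REAL SLICE ONLY — the analytic-continuation clause of (E1) («again an
analytic identity, valid for complex V wherever U_τ is the analytic continuation of the real minimiser») is NOT typed; nothing of Bałaban's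
minimisers instantiated; credit (E1): lens 1 (idea-1 g58); NOT a letter move (the desk prices EJ-1b, PRICING-NE7 v43 §315 N-44-2).  NE7 NOT
PRINTED ∕ NOT PROVED; spine 0∕9; FIXED FINITE T⁴, rung (B)+1; NOT infinite volume, NOT mass gap, NOT Clay.  HONEST DEPENDENCY: continuum YM on
T⁴ ⇐ BetaPertH ∧ nine spine estimates (0/9 proved); BetaPertH ⇐ (D1) ∧ (D4) ∧ CAP+tail; G-an2-4 gates asym, D1 and NE2/3/4.
-/

noncomputable section

open Set MeasureTheory intervalIntegral Finset

namespace Summit.QuantumFields.BalabanUV.T4Continuum.NE7EJBracketIntegral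

open NE7EJBracket

variable {X : Type*}

/-! ### (E1) the envelope integral WITHOUT an envelope theorem: `g(1) − g(0) = ∫₀¹ 𝔇(U_τ) dτ` -/

section Envelope

variable {Ac AB : X → ℝ} {S : Set X} {D : Set ℝ} {u : ℝ → X}

/-- a real number squeezed by `C∕(n+1)` for every `n` is zero. [folklore] -/
theorem eq_zero_of_abs_le_div_succ {x C : ℝ} (h : ∀ n : ℕ, |x| ≤ C / ((n : ℝ) + 1)) : x = 0 := by
  by_contra hx
  have hxpos : 0 < |x| := abs_pos.mpr hx
  have hC : 0 ≤ C := by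
    have := h 0
    simp only [Nat.cast_zero, zero_add, div_one] at this
    linarith
  obtain ⟨n, hn⟩ := exists_nat_gt (C / |x|)
  have h1 := h n
  have hn1 : (0 : ℝ) < (n : ℝ) + 1 := by positivity
  rw [le_div_iff₀ hn1] at h1
  rw [div_lt_iff₀ hxpos] at hn
  have : |x| * ((n : ℝ) + 1) = (n : ℝ) * |x| + |x| := by ring
  linarith

/-- Riemann-sum telescoping of the value: `g(1) − g(0) = Σ_{i<n} (g((i+1)∕n) − g(i∕n))`. [folklore] -/
theorem lineVal_telescope (u : ℝ → X) (n : ℕ) (hn : n ≠ 0) :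
    lineVal Ac AB u 1 - lineVal Ac AB u 0 =
      ∑ i ∈ range n, (lineVal Ac AB u (((i + 1 : ℕ) : ℝ) / n) - lineVal Ac AB u ((i : ℝ) / n)) := by
  have h := Finset.sum_range_sub (fun i : ℕ => lineVal Ac AB u ((i : ℝ) / n)) n
  rw [h, Nat.cast_zero, zero_div, div_self (Nat.cast_ne_zero.mpr hn)]

/-- LOWER AND UPPER RIEMANN BOUNDS FOR THE BRACKET: with minimisers on `[0,1]`, for every `n ≥ 1`,
`Σ_{i<n} 𝔇(u((i+1)∕n)) ≤ n·(g(1) − g(0)) ≤ Σ_{i<n} 𝔇(u(i∕n))`. [folklore] -/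
theorem sum_le_bracket_le_sum (hmem : ∀ τ ∈ Icc (0:ℝ) 1, u τ ∈ S) (hmin : ∀ τ ∈ Icc (0:ℝ) 1, IsMinOn (lineF Ac AB τ) S (u τ))
    (n : ℕ) (hn : n ≠ 0) :
    ∑ i ∈ range n, defect Ac AB (u (((i + 1 : ℕ) : ℝ) / n)) ≤ (n : ℝ) * (lineVal Ac AB u 1 - lineVal Ac AB u 0) ∧
      (n : ℝ) * (lineVal Ac AB u 1 - lineVal Ac AB u 0) ≤ ∑ i ∈ range n, defect Ac AB (u ((i : ℝ) / n)) := by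
  have hnpos : (0 : ℝ) < n := Nat.cast_pos.mpr (Nat.pos_of_ne_zero hn)
  have hmemI : ∀ i : ℕ, i ≤ n → ((i : ℝ) / n) ∈ Icc (0:ℝ) 1 := fun i hi =>
    ⟨div_nonneg (Nat.cast_nonneg _) hnpos.le, by rw [div_le_one hnpos]; exact_mod_cast hi⟩
  have hstep : ∀ i : ℕ, (((i + 1 : ℕ) : ℝ) / n - (i : ℝ) / n) = (n : ℝ)⁻¹ := by
    intro i; push_cast; ring
  rw [lineVal_telescope u n hn, Finset.mul_sum]
  constructor
  · apply Finset.sum_le_sum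
    intro i hi
    have hi' : i + 1 ≤ n := Nat.succ_le_of_lt (Finset.mem_range.mp hi)
    have h := increment_ge (Ac := Ac) (AB := AB) hmem hmin (hmemI i (by omega)) (hmemI (i + 1) hi')
    rw [hstep i, inv_mul_le_iff₀ hnpos] at h
    exact h
  · apply Finset.sum_le_sum
    intro i hi
    have hi' : i + 1 ≤ n := Nat.succ_le_of_lt (Finset.mem_range.mp hi)
    have h := increment_le (Ac := Ac) (AB := AB) hmem hmin (hmemI i (by omega)) (hmemI (i + 1) hi')
    rw [hstep i, le_inv_mul_iff₀ hnpos] at h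
    exact h

/-- LOWER AND UPPER RIEMANN BOUNDS FOR THE INTEGRAL of the antitone integrand: for every `n ≥ 1`,
`Σ_{i<n} 𝔇(u((i+1)∕n)) ≤ n·∫₀¹ 𝔇(u τ)dτ ≤ Σ_{i<n} 𝔇(u(i∕n))` (Mathlib's `AntitoneOn.sum_le_integral ∕ integral_le_sum` rescaled). [folklore] -/
theorem sum_le_integral_le_sum {f : ℝ → ℝ} (hf : AntitoneOn f (Icc (0:ℝ) 1)) (n : ℕ) (hn : n ≠ 0) :
    ∑ i ∈ range n, f (((i + 1 : ℕ) : ℝ) / n) ≤ (n : ℝ) * ∫ τ in (0:ℝ)..1, f τ ∧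
      (n : ℝ) * ∫ τ in (0:ℝ)..1, f τ ≤ ∑ i ∈ range n, f ((i : ℝ) / n) := by
  have hnpos : (0 : ℝ) < n := Nat.cast_pos.mpr (Nat.pos_of_ne_zero hn)
  have hn' : (n : ℝ) ≠ 0 := hnpos.ne'
  -- the rescaled integrand g x := f (x / n) is antitone on [0, n]
  have hg : AntitoneOn (fun x : ℝ => f (x / n)) (Icc (0:ℝ) ((0:ℝ) + n)) := by
    intro x hx y hy hxy
    rw [zero_add] at hx hy
    apply hf
    · exact ⟨div_nonneg hx.1 hnpos.le, by rw [div_le_one hnpos]; exact hx.2⟩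
    · exact ⟨div_nonneg hy.1 hnpos.le, by rw [div_le_one hnpos]; exact hy.2⟩
    · exact div_le_div_of_nonneg_right hxy hnpos.le
  have hscale : (∫ x in (0:ℝ)..(n:ℝ), f (x / n)) = (n : ℝ) * ∫ τ in (0:ℝ)..1, f τ := by
    rw [intervalIntegral.integral_comp_div _ hn', zero_div, div_self hn', smul_eq_mul]
  have h1 := AntitoneOn.sum_le_integral hg
  have h2 := AntitoneOn.integral_le_sum hg
  simp only [zero_add] at h1 h2
  rw [hscale] at h1 h2
  exact ⟨h1, h2⟩

/-- the two Riemann sums differ by the total drop `f 0 − f 1`. [folklore] -/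
theorem sum_sub_sum_eq {f : ℝ → ℝ} (n : ℕ) (hn : n ≠ 0) :
    ∑ i ∈ range n, f ((i : ℝ) / n) - ∑ i ∈ range n, f (((i + 1 : ℕ) : ℝ) / n) = f 0 - f 1 := by
  rw [← Finset.sum_sub_distrib]
  have h := Finset.sum_range_sub' (fun i : ℕ => f ((i : ℝ) / n)) n
  rw [h, Nat.cast_zero, zero_div, div_self (Nat.cast_ne_zero.mpr hn)]

/-- **(E1) THE ENVELOPE INTEGRAL ON THE REAL SLICE, FOR EVERY MINIMISER SELECTION**: if `u τ ∈ S` minimises `A_τ = A_c + τ𝔇` on `S`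
for every `τ ∈ [0,1]`, then `g(1) − g(0) = ∫₀¹ 𝔇(u τ) dτ` — no differentiability, no uniqueness, no Hessian hypothesis: the integrand
is antitone (§2) hence integrable, and both sides are squeezed between the same Riemann sums at every mesh `1∕n`. [folklore] -/
theorem lineVal_one_sub_zero_eq_integral (hmem : ∀ τ ∈ Icc (0:ℝ) 1, u τ ∈ S)
    (hmin : ∀ τ ∈ Icc (0:ℝ) 1, IsMinOn (lineF Ac AB τ) S (u τ)) :
    lineVal Ac AB u 1 - lineVal Ac AB u 0 = ∫ τ in (0:ℝ)..1, defect Ac AB (u τ) := by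
  set f : ℝ → ℝ := fun τ => defect Ac AB (u τ) with hf_def
  have hf : AntitoneOn f (Icc (0:ℝ) 1) := defect_antitoneOn hmem hmin
  set Br := lineVal Ac AB u 1 - lineVal Ac AB u 0 with hBr
  set I := ∫ τ in (0:ℝ)..1, f τ with hI
  have key : ∀ n : ℕ, |Br - I| ≤ (f 0 - f 1) / ((n : ℝ) + 1) := by
    intro n
    have hn : n + 1 ≠ 0 := Nat.succ_ne_zero n
    obtain ⟨hB1, hB2⟩ := sum_le_bracket_le_sum (Ac := Ac) (AB := AB) hmem hmin (n + 1) hn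
    obtain ⟨hI1, hI2⟩ := sum_le_integral_le_sum hf (n + 1) hn
    have hd := sum_sub_sum_eq (f := f) (n + 1) hn
    have hnpos : (0 : ℝ) < ((n + 1 : ℕ) : ℝ) := Nat.cast_pos.mpr (Nat.succ_pos n)
    have hcast : ((n : ℝ) + 1) = ((n + 1 : ℕ) : ℝ) := by push_cast; ring
    rw [hcast, le_div_iff₀ hnpos]
    have hN : |Br - I| * ((n + 1 : ℕ) : ℝ) = |((n + 1 : ℕ) : ℝ) * Br - ((n + 1 : ℕ) : ℝ) * I| := by
      rw [← mul_sub, abs_mul, abs_of_pos hnpos, mul_comm]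
    rw [hN, abs_le]
    constructor <;> linarith
  have h0 : Br - I = 0 := eq_zero_of_abs_le_div_succ key
  exact sub_eq_zero.mp h0

/-- **`Br = ∫₀¹ 𝔇(U_τ) dτ`** for the bracket of the endpoints of the selection (`U^A = u 0`, `U^B = u 1`): lens 1's (E1) verbatim on the real
slice — «the bracket is the AVERAGE of the defect along the path and the two printed minimisers are its endpoints». [folklore] -/
theorem bracket_eq_integral (hmem : ∀ τ ∈ Icc (0:ℝ) 1, u τ ∈ S) (hmin : ∀ τ ∈ Icc (0:ℝ) 1, IsMinOn (lineF Ac AB τ) S (u τ)) :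
    bracket Ac AB (u 0) (u 1) = ∫ τ in (0:ℝ)..1, defect Ac AB (u τ) := by
  rw [bracket_eq_lineVal_sub, lineVal_one_sub_zero_eq_integral hmem hmin]

/-- any two minimisers of `A_c` (resp. `A_B`) on the fibre give the same bracket, so (E1) holds for the bracket of ANY pair of endpoint
minimisers `uA`, `uB` and ANY interpolating selection. [folklore] -/
theorem bracket_eq_integral' {uA uB : X} (hA : IsMinOn Ac S uA) (hB : IsMinOn AB S uB) (huA : uA ∈ S) (huB : uB ∈ S)
    (hmem : ∀ τ ∈ Icc (0:ℝ) 1, u τ ∈ S) (hmin : ∀ τ ∈ Icc (0:ℝ) 1, IsMinOn (lineF Ac AB τ) S (u τ)) :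
    bracket Ac AB uA uB = ∫ τ in (0:ℝ)..1, defect Ac AB (u τ) := by
  rw [← bracket_eq_integral hmem hmin]
  have h0 : (0:ℝ) ∈ Icc (0:ℝ) 1 := ⟨le_refl _, zero_le_one⟩
  have h1 : (1:ℝ) ∈ Icc (0:ℝ) 1 := ⟨zero_le_one, le_refl _⟩
  have hA0 : IsMinOn Ac S (u 0) := by simpa [lineF_zero] using hmin 0 h0
  have hB1 : IsMinOn AB S (u 1) := by simpa [lineF_one] using hmin 1 h1
  have eA : Ac uA = Ac (u 0) := le_antisymm ((isMinOn_iff.mp hA) _ (hmem 0 h0)) ((isMinOn_iff.mp hA0) _ huA)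
  have eB : AB uB = AB (u 1) := le_antisymm ((isMinOn_iff.mp hB) _ (hmem 1 h1)) ((isMinOn_iff.mp hB1) _ huB)
  simp only [bracket_def, eA, eB]

end Envelope

end Summit.QuantumFields.BalabanUV.T4Continuum.NE7EJBracketIntegral

end
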